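import Summits.CriticalPhenomena.PercolationContinuityZ3.Theorems.PercNearOneGluingNoHeavyPcintBSMRZ8QSCert
import HarnessLib

/-!
# PCINT lane, PHASE 12 (site plane method for `d = 8`, reach-4 pieces (two-turn family), long horizon): kernel check 18/24 of the site certificate inequalities for `ℤ^8` at the cell `0.1308`

Cell `prim-pcint`, seat `prim-pcint-4` (gen 0); memo `run/shared/lean/prim/pcint/T-FIBRE-ROUTE.md` §PHASE 12.
Instance `Z8QS`: `d = 8 = 6 + 2` (`k = 6` time axes, the transverse plane), SITE percolation, 337 two-turn reach-4 pieces
(`BSMR.pc4`), 9-point law `A/DA = [1, 2, 14, 80, 806, 80, 14, 2, 1]/1000`, horizon `N = 150` in `3` chunks of `50` (window half-width `74`),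
coefficient tables exact below `M` and flat beyond (…PcintBSMRCoefFlat), Fourier tail (cut-off data, `θ₀ = 1/2`, `q₀ = 25`)
`T = 3884435/10^12`, cell `p = 1308/10^4`. One `decide +kernel` per
representative (kernel memory), bit-mask site functional `BSMR.certFastMS`.
-/

namespace Summit.CriticalPhenomena.PercolationContinuityZ3.Theorems.Pcint.BSMR.Z8QS

open Summit.CriticalPhenomena.PercolationContinuityZ3.Theorems.Pcint.BSMR Summit.CriticalPhenomena.PercolationContinuityZ3.Theorems.Pcint.BSMX Summit.CriticalPhenomena.PercolationContinuityZ3.Theorems.Pcint.BSM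

set_option maxHeartbeats 0 in
set_option maxRecDepth 65536 in
/-- The site certificate inequality at `![3, 0]` (cell `0.1308`, site `ℤ^8`). -/
theorem hrep_18a : ∀ y ∈ [(![3, 0] : Fin 2 → ℤ)], certFastMS RS 6 10000 1308 9 V0t V1t (tr2 y) (shOfV (tr2 y)) ≤ Φn y * (1308 ^ 9 * 6 * 840000000 ^ 2 * (1000000000000 * 1)) := by
  decide +kernel

/-- The site certificate inequalities on the offsets `((reps8.drop 38).take 1)` (cell `0.1308`). -/
theorem hrep_18 : ∀ y ∈ ((reps8.drop 38).take 1), certFastMS RS 6 10000 1308 9 V0t V1t (tr2 y) (shOfV (tr2 y)) ≤ Φn y * (1308 ^ 9 * 6 * 840000000 ^ 2 * (1000000000000 * 1)) := by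
  intro y hy
  have hl : ((reps8.drop 38).take 1) = [(![3, 0] : Fin 2 → ℤ)] := by decide +kernel
  rw [hl] at hy
  simp only [List.mem_cons, List.not_mem_nil, or_false] at hy
  subst hy
  · exact hrep_18a _ (List.mem_singleton.2 rfl)

end Summit.CriticalPhenomena.PercolationContinuityZ3.Theorems.Pcint.BSMR.Z8QS
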